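import Summits.QuantumFields.YangMills.Theorems.AlphaInputsT3ACv3ModelBox
import Summits.QuantumFields.YangMills.Theorems.AlphaInputsT3ACv3TubeLetters
import HarnessLib

/-!
# `AlphaInputsT3ACv3ModelBoxExpCurl` — START v3 letters on ★w1-19936 g2 LEAD's MODEL BOX (`…ModelBox`, p597788): **THE PLAQUETTES OF AN EXPONENTIAL MODEL FIELD TO SECOND ORDER** —
# for an `𝔰𝔲(n)`-valued model 1-form `X` with `‖X‖ ≤ δ` on the four bonds of `(u; μ, ν)` (`4δ ≤ 1`), the field `u μ ↦ expSU (X u μ)` has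
# `dist1 (plaqB U u μ ν) ≤ ‖curlB X u μ ν‖ + 16δ²` (★w4's product-of-exponentials letter at the trivial background, read on the box) — the bridge from the (S4) fill
# (`…TransfiniteFillBox`: `‖curlB (fillB R A)‖ ≤ b + 4a∕R`, `‖fillB‖ ≤ 3a`) to the plaquettes of the START field `exp(fill)` in the cube: `≤ b + 4a∕R + 144a²` —
# cell `ym3-torus`, width seat `ym-ust-19936-w3` (g0)

WHY (memo `NONABELIAN-FL-START-w1-g2.md` §3 (B): «then `U := (e^{A})^{σ̃⁻¹}` has plaquettes `≤ C(b + a∕R) + O(a²)` inside Q»).  The `O(a²)` is the second-order term of the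
four-factor product `e^{X₁}e^{X₂}e^{−X₃}e^{−X₄} = 1 + (X₁+X₂−X₃−X₄) + O(δ²)`; the linear term is the model curl.  THIS FILE (def-free, d-generic, any `n`):
`expSU_inv'` (`(expSU X)⁻¹ = expSU (−X)`), `coe_plaqB_expSU` (the plaquette of `expSU ∘ X` as the four-factor matrix product), `coe_curlB_lieSU` (the curl of an `𝔰𝔲`-valued form,
read in matrices), ★★ `dist1_plaqB_expSU_le` (`≤ ‖curlB X‖ + 16δ²`), `dist1_plaqB_expSU_le'` (the same with `e^{4δ} − 1 − 4δ`, no `4δ ≤ 1`), and the gauge-covariant reading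
`dist1_plaqB_gaugeB_expSU_le` (`(expSU ∘ X)^g` has the same plaquette distances — LEAD's `dist1_plaqB_gaugeB`).  Appendix: the CONVERSE reading
`norm_curlB_le_dist1_plaqB_expSU_add(')` (`‖curlB X‖ ≤ dist1 (plaqB (expSU ∘ X)) + 16δ²`) — the (S3) → (S4) interface (logarithms of a boundary field with small plaquettes have small curl).
HONEST FRAMING.  Elementary normed-algebra bookkeeping; nothing of [Balaban1985UV3]∕[Balaban1985Variational]∕[Balaban1985Averaging] is asserted; the START, (FL)∕`hLift`, the
stub 2′χ, the crux `HistoryTailL` and any gap are NOT claimed; count-neutral helper (`--supports stmt-QuantumFields-19936`); registry untouched.  YM₃ on the three-torus is a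
RUNG of the programme, not the Clay problem; nothing here is about d = 4, infinite volume or a mass gap.

References: W. Rossmann, Lie Groups (OUP 2002) §1.3 [Rossmann2002] (product of exponentials to second order); T. Bałaban, Commun. Math. Phys. 98 (1985) 17–51
[Balaban1985Averaging] ((9) p.19 plaquette variables, (19) p.21 the operator norm).
-/

set_option autoImplicit false

open scoped Matrix.Norms.L2Operator
open NormedSpace

namespace Summit.QuantumFields.YangMills.Theorems.ModelBox

open Literature.MathematicalPhysics.QuantumFieldTheory.Balaban1983to89
open Literature.MathematicalPhysics.QuantumFieldTheory.Balaban1983to89.T4AdjointCovarianceUnitary (lieSU expSU coe_expSU)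
open Summit.QuantumFields.YangMills.Theorems.PerturbedPlaquette (dist1_SU_eq norm_prodExp_four_sub_one_sub_sum_le exp_four_mul_sub_le_sq)
open Summit.QuantumFields.YangMills.Theorems.TubeStart (expSU_smul_inv)

variable {d : ℕ} {n : Type*} [Fintype n] [DecidableEq n]

/-- `(expSU X)⁻¹ = expSU (−X)`. [cite: Rossmann2002, §1.1] -/
theorem expSU_inv' (X : lieSU n) : (expSU X)⁻¹ = expSU (-X) := by
  simpa using expSU_smul_inv X 1

/-- **THE PLAQUETTE OF AN EXPONENTIAL FIELD** as a four-factor matrix product `e^{X₁}·e^{X₂}·e^{−X₃}·e^{−X₄}`. [cite: Balaban1985Averaging, (9) p.19] -/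
theorem coe_plaqB_expSU (X : (Fin d → ℤ) → Fin d → lieSU n) (u : Fin d → ℤ) (μ ν : Fin d) :
    ((plaqB (fun v κ => expSU (X v κ)) u μ ν : Matrix.specialUnitaryGroup n ℂ) : Matrix n n ℂ) =
      exp ((X u μ : lieSU n) : Matrix n n ℂ) * exp ((X (u + e μ) ν : lieSU n) : Matrix n n ℂ) * exp (-((X (u + e ν) μ : lieSU n) : Matrix n n ℂ)) *
        exp (-((X u ν : lieSU n) : Matrix n n ℂ)) := by
  rw [plaqB_def, expSU_inv', expSU_inv']
  simp only [Submonoid.coe_mul, coe_expSU, Submodule.coe_neg]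

omit [DecidableEq n] in
/-- The curl of an `𝔰𝔲(n)`-valued model form, read in matrices. [folklore] -/
theorem coe_curlB_lieSU (X : (Fin d → ℤ) → Fin d → lieSU n) (u : Fin d → ℤ) (μ ν : Fin d) :
    ((curlB X u μ ν : lieSU n) : Matrix n n ℂ) =
      ((X u μ : lieSU n) : Matrix n n ℂ) + ((X (u + e μ) ν : lieSU n) : Matrix n n ℂ) - ((X (u + e ν) μ : lieSU n) : Matrix n n ℂ) - ((X u ν : lieSU n) : Matrix n n ℂ) := by
  simp only [curlB_def, Submodule.coe_add, Submodule.coe_sub]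

/-- **THE PLAQUETTES OF AN EXPONENTIAL FIELD TO SECOND ORDER, exponential form**: `dist1 (plaqB (expSU ∘ X) u μ ν) ≤ ‖curlB X u μ ν‖ + (e^{4δ} − 1 − 4δ)` from `‖X‖ ≤ δ` on the four
bonds. [cite: Rossmann2002, §1.3 Theorem 1] -/
theorem dist1_plaqB_expSU_le' [Nonempty n] (X : (Fin d → ℤ) → Fin d → lieSU n) (u : Fin d → ℤ) (μ ν : Fin d) {δ : ℝ}
    (h1 : ‖((X u μ : lieSU n) : Matrix n n ℂ)‖ ≤ δ) (h2 : ‖((X (u + e μ) ν : lieSU n) : Matrix n n ℂ)‖ ≤ δ) (h3 : ‖((X (u + e ν) μ : lieSU n) : Matrix n n ℂ)‖ ≤ δ)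
    (h4 : ‖((X u ν : lieSU n) : Matrix n n ℂ)‖ ≤ δ) :
    GaugeGroup.dist1 (plaqB (fun v κ => expSU (X v κ)) u μ ν) ≤ ‖((curlB X u μ ν : lieSU n) : Matrix n n ℂ)‖ + (Real.exp (4 * δ) - 1 - 4 * δ) := by
  rw [dist1_SU_eq, coe_plaqB_expSU, coe_curlB_lieSU]
  set x₁ : Matrix n n ℂ := ((X u μ : lieSU n) : Matrix n n ℂ)
  set x₂ : Matrix n n ℂ := ((X (u + e μ) ν : lieSU n) : Matrix n n ℂ)
  set x₃ : Matrix n n ℂ := ((X (u + e ν) μ : lieSU n) : Matrix n n ℂ)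
  set x₄ : Matrix n n ℂ := ((X u ν : lieSU n) : Matrix n n ℂ)
  have hE := norm_prodExp_four_sub_one_sub_sum_le x₁ x₂ (-x₃) (-x₄) h1 h2 (by rwa [norm_neg]) (by rwa [norm_neg])
  have e1 : exp x₁ * exp x₂ * exp (-x₃) * exp (-x₄) - 1 = (exp x₁ * exp x₂ * exp (-x₃) * exp (-x₄) - 1 - (x₁ + x₂ + -x₃ + -x₄)) + (x₁ + x₂ - x₃ - x₄) := by abel
  rw [e1]
  calc ‖(exp x₁ * exp x₂ * exp (-x₃) * exp (-x₄) - 1 - (x₁ + x₂ + -x₃ + -x₄)) + (x₁ + x₂ - x₃ - x₄)‖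
      ≤ ‖exp x₁ * exp x₂ * exp (-x₃) * exp (-x₄) - 1 - (x₁ + x₂ + -x₃ + -x₄)‖ + ‖x₁ + x₂ - x₃ - x₄‖ := norm_add_le _ _
    _ ≤ (Real.exp (4 * δ) - 1 - 4 * δ) + ‖x₁ + x₂ - x₃ - x₄‖ := by gcongr
    _ = ‖x₁ + x₂ - x₃ - x₄‖ + (Real.exp (4 * δ) - 1 - 4 * δ) := add_comm _ _

/-- **★★ THE PLAQUETTES OF AN EXPONENTIAL FIELD TO SECOND ORDER**: for an `𝔰𝔲(n)`-valued model form with `‖X‖ ≤ δ` on the four bonds of `(u; μ, ν)` and `4δ ≤ 1`,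
`dist1 (plaqB (expSU ∘ X) u μ ν) ≤ ‖curlB X u μ ν‖ + 16·δ²`. [cite: Rossmann2002, §1.3 Theorem 1] -/
theorem dist1_plaqB_expSU_le [Nonempty n] (X : (Fin d → ℤ) → Fin d → lieSU n) (u : Fin d → ℤ) (μ ν : Fin d) {δ : ℝ} (hδ : 4 * δ ≤ 1)
    (h1 : ‖((X u μ : lieSU n) : Matrix n n ℂ)‖ ≤ δ) (h2 : ‖((X (u + e μ) ν : lieSU n) : Matrix n n ℂ)‖ ≤ δ) (h3 : ‖((X (u + e ν) μ : lieSU n) : Matrix n n ℂ)‖ ≤ δ)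
    (h4 : ‖((X u ν : lieSU n) : Matrix n n ℂ)‖ ≤ δ) :
    GaugeGroup.dist1 (plaqB (fun v κ => expSU (X v κ)) u μ ν) ≤ ‖((curlB X u μ ν : lieSU n) : Matrix n n ℂ)‖ + 16 * δ ^ 2 := by
  have hδ0 : 0 ≤ δ := (norm_nonneg _).trans h1
  linarith [dist1_plaqB_expSU_le' X u μ ν h1 h2 h3 h4, exp_four_mul_sub_le_sq hδ0 hδ]

/-- **GAUGE-COVARIANT READING**: the gauged exponential field `(expSU ∘ X)^g` has the same plaquette distances, hence the same bound. [cite: Balaban1985Averaging, (12) p.19] -/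
theorem dist1_plaqB_gaugeB_expSU_le [Nonempty n] (g : (Fin d → ℤ) → Matrix.specialUnitaryGroup n ℂ) (X : (Fin d → ℤ) → Fin d → lieSU n) (u : Fin d → ℤ) (μ ν : Fin d)
    {δ : ℝ} (hδ : 4 * δ ≤ 1)
    (h1 : ‖((X u μ : lieSU n) : Matrix n n ℂ)‖ ≤ δ) (h2 : ‖((X (u + e μ) ν : lieSU n) : Matrix n n ℂ)‖ ≤ δ) (h3 : ‖((X (u + e ν) μ : lieSU n) : Matrix n n ℂ)‖ ≤ δ)
    (h4 : ‖((X u ν : lieSU n) : Matrix n n ℂ)‖ ≤ δ) :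
    GaugeGroup.dist1 (plaqB (gaugeB g (fun v κ => expSU (X v κ))) u μ ν) ≤ ‖((curlB X u μ ν : lieSU n) : Matrix n n ℂ)‖ + 16 * δ ^ 2 := by
  rw [dist1_plaqB_gaugeB]
  exact dist1_plaqB_expSU_le X u μ ν hδ h1 h2 h3 h4

/-- **SUP FORM**: with `‖X‖ ≤ δ` on all bonds and `‖curlB X‖ ≤ c` at the plaquette, `dist1 ≤ c + 16δ²`. [cite: Rossmann2002, §1.3 Theorem 1] -/
theorem dist1_plaqB_expSU_le_of_sup [Nonempty n] (X : (Fin d → ℤ) → Fin d → lieSU n) {δ c : ℝ} (hδ : 4 * δ ≤ 1)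
    (hX : ∀ v κ, ‖((X v κ : lieSU n) : Matrix n n ℂ)‖ ≤ δ) (u : Fin d → ℤ) (μ ν : Fin d) (hc : ‖((curlB X u μ ν : lieSU n) : Matrix n n ℂ)‖ ≤ c) :
    GaugeGroup.dist1 (plaqB (fun v κ => expSU (X v κ)) u μ ν) ≤ c + 16 * δ ^ 2 :=
  (dist1_plaqB_expSU_le X u μ ν hδ (hX _ _) (hX _ _) (hX _ _) (hX _ _)).trans (by linarith)

/-! ## Appendix (g0, 02:5xZ): the converse reading — the curl FROM the plaquette (the (S3) → (S4) interface) -/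

/-- **THE CURL FROM THE PLAQUETTE, exponential form**: `‖curlB X u μ ν‖ ≤ dist1 (plaqB (expSU ∘ X) u μ ν) + (e^{4δ} − 1 − 4δ)` from `‖X‖ ≤ δ` on the four bonds — so the
logarithms of a boundary field with small plaquettes have small curl (the `hB` input of `…TransfiniteFillBox`∕`…TransfiniteFillExp`). [cite: Rossmann2002, §1.3 Theorem 1] -/
theorem norm_curlB_le_dist1_plaqB_expSU_add' [Nonempty n] (X : (Fin d → ℤ) → Fin d → lieSU n) (u : Fin d → ℤ) (μ ν : Fin d) {δ : ℝ}
    (h1 : ‖((X u μ : lieSU n) : Matrix n n ℂ)‖ ≤ δ) (h2 : ‖((X (u + e μ) ν : lieSU n) : Matrix n n ℂ)‖ ≤ δ) (h3 : ‖((X (u + e ν) μ : lieSU n) : Matrix n n ℂ)‖ ≤ δ)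
    (h4 : ‖((X u ν : lieSU n) : Matrix n n ℂ)‖ ≤ δ) :
    ‖((curlB X u μ ν : lieSU n) : Matrix n n ℂ)‖ ≤ GaugeGroup.dist1 (plaqB (fun v κ => expSU (X v κ)) u μ ν) + (Real.exp (4 * δ) - 1 - 4 * δ) := by
  rw [dist1_SU_eq, coe_plaqB_expSU, coe_curlB_lieSU]
  set x₁ : Matrix n n ℂ := ((X u μ : lieSU n) : Matrix n n ℂ)
  set x₂ : Matrix n n ℂ := ((X (u + e μ) ν : lieSU n) : Matrix n n ℂ)
  set x₃ : Matrix n n ℂ := ((X (u + e ν) μ : lieSU n) : Matrix n n ℂ)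
  set x₄ : Matrix n n ℂ := ((X u ν : lieSU n) : Matrix n n ℂ)
  have hE := norm_prodExp_four_sub_one_sub_sum_le x₁ x₂ (-x₃) (-x₄) h1 h2 (by rwa [norm_neg]) (by rwa [norm_neg])
  have e1 : x₁ + x₂ - x₃ - x₄ = (exp x₁ * exp x₂ * exp (-x₃) * exp (-x₄) - 1) - (exp x₁ * exp x₂ * exp (-x₃) * exp (-x₄) - 1 - (x₁ + x₂ + -x₃ + -x₄)) := by abel
  rw [e1]
  exact (norm_sub_le _ _).trans (by linarith)

/-- **★ THE CURL FROM THE PLAQUETTE**: `‖curlB X u μ ν‖ ≤ dist1 (plaqB (expSU ∘ X) u μ ν) + 16δ²` (`‖X‖ ≤ δ` on the four bonds, `4δ ≤ 1`). [cite: Rossmann2002, §1.3 Theorem 1] -/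
theorem norm_curlB_le_dist1_plaqB_expSU_add [Nonempty n] (X : (Fin d → ℤ) → Fin d → lieSU n) (u : Fin d → ℤ) (μ ν : Fin d) {δ : ℝ} (hδ : 4 * δ ≤ 1)
    (h1 : ‖((X u μ : lieSU n) : Matrix n n ℂ)‖ ≤ δ) (h2 : ‖((X (u + e μ) ν : lieSU n) : Matrix n n ℂ)‖ ≤ δ) (h3 : ‖((X (u + e ν) μ : lieSU n) : Matrix n n ℂ)‖ ≤ δ)
    (h4 : ‖((X u ν : lieSU n) : Matrix n n ℂ)‖ ≤ δ) :
    ‖((curlB X u μ ν : lieSU n) : Matrix n n ℂ)‖ ≤ GaugeGroup.dist1 (plaqB (fun v κ => expSU (X v κ)) u μ ν) + 16 * δ ^ 2 := by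
  have hδ0 : 0 ≤ δ := (norm_nonneg _).trans h1
  linarith [norm_curlB_le_dist1_plaqB_expSU_add' X u μ ν h1 h2 h3 h4, exp_four_mul_sub_le_sq hδ0 hδ]

/-- The same for a GAUGED exponential field: the plaquette distance of `(expSU ∘ X)^g` controls the curl of `X` equally. [cite: Balaban1985Averaging, (12) p.19] -/
theorem norm_curlB_le_dist1_plaqB_gaugeB_expSU_add [Nonempty n] (g : (Fin d → ℤ) → Matrix.specialUnitaryGroup n ℂ) (X : (Fin d → ℤ) → Fin d → lieSU n) (u : Fin d → ℤ)
    (μ ν : Fin d) {δ : ℝ} (hδ : 4 * δ ≤ 1)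
    (h1 : ‖((X u μ : lieSU n) : Matrix n n ℂ)‖ ≤ δ) (h2 : ‖((X (u + e μ) ν : lieSU n) : Matrix n n ℂ)‖ ≤ δ) (h3 : ‖((X (u + e ν) μ : lieSU n) : Matrix n n ℂ)‖ ≤ δ)
    (h4 : ‖((X u ν : lieSU n) : Matrix n n ℂ)‖ ≤ δ) :
    ‖((curlB X u μ ν : lieSU n) : Matrix n n ℂ)‖ ≤ GaugeGroup.dist1 (plaqB (gaugeB g (fun v κ => expSU (X v κ))) u μ ν) + 16 * δ ^ 2 := by
  rw [dist1_plaqB_gaugeB]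
  exact norm_curlB_le_dist1_plaqB_expSU_add X u μ ν hδ h1 h2 h3 h4

end Summit.QuantumFields.YangMills.Theorems.ModelBox
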